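import Literature.NumberTheory.DiophantineGeometry.AbcDarmonGranvilleBelyiMapReduction
import Literature.NumberTheory.DiophantineGeometry.HyperbolicSignatureCover
import HarnessLib

/-!
# Darmon–Granville's Theorem 2 from Faltings' theorem and the `(p, q, r)`-covering fact

Topic `Literature/NumberTheory/DiophantineGeometry`. Theorem-only file: the two-line assembly of the
ACCEPTED reduction `darmonGranville1995_thm_2_of_belyiMap_of_faltings`
(`AbcDarmonGranvilleBelyiMapReduction.lean`) with the named fact `exists_signatureCover_numberField`
(`HyperbolicSignatureCover.lean`, Bombieri–Gubler Cor. 12.6.7/12.6.8 = Darmon–Granville Prop. 3.1), so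
that the named fact `AbcWave0.darmonGranville1995_thm_2` (Darmon–Granville 1995, Theorem 2) is closed
MODULO Faltings' theorem `finite_ratPlaces_of_two_le_genus` (named fact, `MordellFunctionField.lean`)
alone.

## References

* H. Darmon, A. Granville, Bull. London Math. Soc. 27 (1995) 513–543, Theorem 2 and its proof
  (pp. 526–527), Prop. 3.1. [DarmonGranville1995]
* E. Bombieri, W. Gubler, *Heights in Diophantine Geometry*, CUP 2006, Cor. 12.6.7, 12.6.8.
  [BombieriGubler2006]
-/

noncomputable section

namespace Literature.NumberTheory.DiophantineGeometry

open AlgFunctionField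

/-- **Darmon–Granville 1995, Theorem 2, from Faltings' theorem** (and the Riemann-existence covering
fact `exists_signatureCover_numberField`): for `1/p + 1/q + 1/r < 1` and `A B C ≠ 0`, the equation
`A x^p + B y^q = C z^r` has finitely many proper solutions. [cite: DarmonGranville1995, Theorem 2 (proof pp. 526–527)] -/
theorem darmonGranville1995_thm_2_of_faltings (hRET : exists_signatureCover_numberField)
    (hFaltings : ∀ (K' : Type) [Field K'] (F' : Type) [Field F'] [Algebra K' F'],
      finite_ratPlaces_of_two_le_genus K' F') :
    darmonGranville1995_thm_2 :=
  darmonGranville1995_thm_2_of_belyiMap_of_faltings hRET hFaltings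

end Literature.NumberTheory.DiophantineGeometry
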